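import Literature.Analysis.FluidPDE.OnsagerBDSVPotentialTheory
import Literature.Analysis.FunctionSpaces.ContDiffHolderAlgebra
import Literature.Analysis.FunctionSpaces.HolderNormTorusProofs
import HarnessLib

/-!
# `ℛ` is bounded on `C^{0,α}(T³)`, from the Calderón–Zygmund bound for `∂ᵢ∂ⱼΔ⁻¹`

Buckmaster–De Lellis–Székelyhidi–Vicol 2019, App. C, Prop. C.1 (periodic Calderón–Zygmund
operators are bounded on zero-mean `C^α(T³)`) enters the tree as the named fact
`BDSV.holderCZBound` (`OnsagerBDSVPotentialTheory.lean`): `‖∂ᵢ∂ⱼΔ⁻¹ f‖_{C^{0,α}} ≤ C(α) ‖f‖_{C^{0,α}}`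
for smooth real `f`. The De Lellis–Székelyhidi antidivergence `ℛ` (`Torus.antidivergence`,
`(ℛv)ᵢⱼ = ∂ᵢΔ⁻¹vⱼ + ∂ⱼΔ⁻¹vᵢ - ½δᵢⱼ div Δ⁻¹v - ½∂ᵢ∂ⱼΔ⁻¹ div Δ⁻¹v` on `T³`) is built from the
order `-1` operators `∂ᵢΔ⁻¹` and the order `0` operators `∂ᵢ∂ⱼΔ⁻¹`; this file PROVES, from
`BDSV.holderCZBound` as a hypothesis, the two consequences used throughout BDSV §6 (where `ℛ`
is applied to sums — e.g. the Fourier expansion of the perturbation, mode by mode plus a tail —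
and each `‖ℛF‖_α` is controlled by `‖F‖_α` whenever no oscillation is exploited):

* `BDSV.holder_partialDeriv_invLaplacian_le`: `‖∂ᵢΔ⁻¹ f‖_{C^{0,α}} ≤ C ‖f‖_{C^{0,α}}` for smooth
  real `f` — `∂ᵢΔ⁻¹f` has zero mean and partial derivatives `∂ₗ∂ᵢΔ⁻¹ f` bounded by the fact, so it
  is Lipschitz (`Torus.lipschitzWith_of_norm_partialDeriv_le`), hence small in sup norm
  (`Torus.norm_le_of_integral_eq_zero`: a zero-mean `K`-Lipschitz real function on `T^d` is bounded
  by `K/2`) and `α`-Hölder (`Torus.eBoundedHolderNorm_le_of_norm_le_of_norm_partialDeriv_le`);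
* `BDSV.holder_antidivergence_le`: **`‖ℛv‖_{C^{0,α}} ≤ C ‖v‖_{C^{0,α}}`** for smooth `v : T³ → ℝ³`;
* `BDSV.holder_antidivergence_tensorDivergence_le`: **`‖ℛ(div A)‖_{C^{0,α}} ≤ C ‖A‖_{C^{0,α}}`** for
  smooth tensor fields `A` (`ℛ ∘ div` is of order `0`: `∂ᵢΔ⁻¹(div A)ⱼ = Σₗ ∂ᵢ∂ₗΔ⁻¹Aⱼₗ`) — the bound
  "`‖𝒪₂‖_α ≲ ‖w_o ⊗ w_c + w_c ⊗ w_o + w_c ⊗ w_c‖_α`" of BDSV §6.1.3 (arXiv (6.9)); both through the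
  bookkeeping lemma `BDSV.holder_antidivergence_le_of_potential_bound`.

Supporting generic lemmas on the accepted norms `Torus.eContDiffHolderNorm 0 r`:
`Torus.eContDiffHolderNorm_zero_le_eBoundedHolderNorm` (lifted `≤` intrinsic norm, `proj` being
`1`-Lipschitz), `Torus.eContDiffHolderNorm_zero_clm_comp_le` (post-composition with a continuous
linear map), `Torus.eContDiffHolderNorm_zero_apply_le` (components of Euclidean-valued maps),
`Torus.norm_le_of_integral_eq_zero`.

## References

* T. Buckmaster, C. De Lellis, L. Székelyhidi Jr., V. Vicol, *Onsager's conjecture for admissible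
  weak solutions*, CPAM 72 (2019) = arXiv:1701.08678, App. C Prop. C.1; §4.2 (4.1) and
  De Lellis–Székelyhidi 2013 §4.1 (`ℛ`); §6.1.3 (uses).
* D. Gilbarg, N. Trudinger, *Elliptic PDE of second order* (2001), §4.1 (`C¹ ⊂ C^{0,α}`).
-/

noncomputable section

open MeasureTheory Set Function
open scoped NNReal ENNReal ContDiff

/-! ## Generic lemmas on `‖·‖_{C^{0,r}(T^d)}` -/

namespace Literature.Analysis.FunctionSpaces

namespace Torus

variable {d : Type*} [Fintype d]
variable {Y Y' : Type*} [NormedAddCommGroup Y] [NormedSpace ℝ Y] [NormedAddCommGroup Y']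
  [NormedSpace ℝ Y']

/-- The lifted `C^{0,r}` norm is dominated by the intrinsic one: `‖g‖_{C^{0,r}(T^d)} ≤ ‖g‖_∞ + [g]_r`
(`lift g = g ∘ proj` with `proj` `1`-Lipschitz). [folklore] -/
theorem eContDiffHolderNorm_zero_le_eBoundedHolderNorm (r : ℝ≥0) (g : UnitAddTorus d → Y) :
    Torus.eContDiffHolderNorm 0 r g ≤ eBoundedHolderNorm r g := by
  rw [Torus.eContDiffHolderNorm, eContDiffHolderNorm_zero_eq, eSupNorm_lift]
  exact add_le_add le_rfl (eHolderNorm_comp_le_of_lipschitz lipschitzWith_proj)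

omit [NormedSpace ℝ Y] [NormedSpace ℝ Y'] in
/-- Post-composition with a `K`-Lipschitz map scales the Hölder seminorm by at most `K`. [folklore] -/
theorem eHolderNorm_comp_le_mul {X : Type*} [MetricSpace X] (r : ℝ≥0) {L : Y → Y'} {K : ℝ≥0}
    (hL : LipschitzWith K L) (G : X → Y) :
    eHolderNorm r (L ∘ G) ≤ (K : ℝ≥0∞) * eHolderNorm r G := by
  by_cases hG : MemHolder r G
  · have hGH : HolderWith (nnHolderNorm r G) r G := hG.holderWith
    have hH : HolderWith (K * nnHolderNorm r G) r (L ∘ G) := by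
      intro x y
      have h1 : edist (L (G x)) (L (G y)) ≤ (K : ℝ≥0∞) * edist (G x) (G y) := hL (G x) (G y)
      have h2 : edist (G x) (G y) ≤ (nnHolderNorm r G : ℝ≥0∞) * edist x y ^ (r : ℝ) := hGH x y
      calc edist ((L ∘ G) x) ((L ∘ G) y) ≤ (K : ℝ≥0∞) * edist (G x) (G y) := h1
        _ ≤ (K : ℝ≥0∞) * ((nnHolderNorm r G : ℝ≥0∞) * edist x y ^ (r : ℝ)) :=
            mul_le_mul_of_nonneg_left h2 bot_le
        _ = ((K * nnHolderNorm r G : ℝ≥0) : ℝ≥0∞) * edist x y ^ (r : ℝ) := by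
            rw [ENNReal.coe_mul, mul_assoc]
    refine hH.eHolderNorm_le.trans (le_of_eq ?_)
    rw [ENNReal.coe_mul, hG.coe_nnHolderNorm_eq_eHolderNorm]
  · have htop : eHolderNorm r G = ⊤ := by
      rwa [← eHolderNorm_ne_top, not_ne_iff] at hG
    rw [htop]
    by_cases hK : K = 0
    · have h0 : eHolderNorm r (L ∘ G) = 0 := by
        rw [eHolderNorm_eq_zero]
        intro x y
        have h := hL (G x) (G y)
        rw [hK, ENNReal.coe_zero, zero_mul, nonpos_iff_eq_zero, edist_eq_zero] at h
        exact h
      rw [h0]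
      exact bot_le
    · rw [ENNReal.mul_top (by exact_mod_cast hK)]
      exact le_top

/-- **Post-composition with a continuous linear map**:
`‖L ∘ g‖_{C^{0,r}(T^d)} ≤ ‖L‖ ‖g‖_{C^{0,r}(T^d)}`. [folklore] -/
theorem eContDiffHolderNorm_zero_clm_comp_le (L : Y →L[ℝ] Y') (r : ℝ≥0) (g : UnitAddTorus d → Y) :
    Torus.eContDiffHolderNorm 0 r (fun x => L (g x)) ≤ ‖L‖₊ * Torus.eContDiffHolderNorm 0 r g := by
  rw [Torus.eContDiffHolderNorm, Torus.eContDiffHolderNorm, eContDiffHolderNorm_zero_eq,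
    eContDiffHolderNorm_zero_eq, mul_add]
  have hlift : lift (fun x => L (g x)) = L ∘ lift g := rfl
  rw [hlift]
  refine add_le_add ?_ (eHolderNorm_comp_le_mul r L.lipschitz (lift g))
  refine iSup_le fun y => ?_
  calc ‖(L ∘ lift g) y‖ₑ ≤ ‖L‖ₑ * ‖lift g y‖ₑ := L.le_opENorm _
    _ ≤ ‖L‖₊ * eSupNorm (lift g) := by
        rw [enorm_eq_nnnorm]
        exact mul_le_mul_of_nonneg_left (enorm_le_eSupNorm _ y) bot_le

/-- Components of a Euclidean-valued map: `‖x ↦ g(x)ⱼ‖_{C^{0,r}} ≤ ‖g‖_{C^{0,r}}`. [folklore] -/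
theorem eContDiffHolderNorm_zero_apply_le {ι : Type*} [Fintype ι] (r : ℝ≥0)
    (g : UnitAddTorus d → EuclideanSpace ℝ ι) (j : ι) :
    Torus.eContDiffHolderNorm 0 r (fun x => g x j) ≤ Torus.eContDiffHolderNorm 0 r g := by
  have h := eContDiffHolderNorm_zero_clm_comp_le (EuclideanSpace.proj (𝕜 := ℝ) j) r g
  have hn : ‖(EuclideanSpace.proj (𝕜 := ℝ) j : EuclideanSpace ℝ ι →L[ℝ] ℝ)‖₊ ≤ 1 := by
    rw [← NNReal.coe_le_coe, coe_nnnorm, NNReal.coe_one]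
    refine ContinuousLinearMap.opNorm_le_bound _ zero_le_one fun v => ?_
    rw [one_mul]
    exact PiLp.norm_apply_le v j
  calc Torus.eContDiffHolderNorm 0 r (fun x => g x j)
      ≤ ‖(EuclideanSpace.proj (𝕜 := ℝ) j : EuclideanSpace ℝ ι →L[ℝ] ℝ)‖₊ *
          Torus.eContDiffHolderNorm 0 r g := h
    _ ≤ 1 * Torus.eContDiffHolderNorm 0 r g := by
        gcongr
        exact_mod_cast hn
    _ = _ := one_mul _

/-- **A zero-mean Lipschitz real function on `T^d` is small**: if `∫ g = 0` and `g` is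
`K`-Lipschitz (intrinsic metric, in which `T^d = (ℝ/ℤ)^d` has diameter `1/2`), then `|g(x)| ≤ K/2`
(`g(y) ≥ g(x) - K/2` for all `y`, integrate over the probability space `T^d`). [folklore] -/
theorem norm_le_of_integral_eq_zero {g : UnitAddTorus d → ℝ} (hg : Continuous g)
    (h0 : ∫ x, g x = 0) {K : ℝ≥0} (hK : LipschitzWith K g) (x : UnitAddTorus d) :
    ‖g x‖ ≤ K / 2 := by
  have hdist : ∀ y : UnitAddTorus d, dist x y ≤ 1 / 2 := by
    intro y
    refine (dist_pi_le_iff (by norm_num)).2 fun i => ?_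
    rw [dist_eq_norm]
    have := AddCircle.norm_le_half_period (1 : ℝ) (x := x i - y i) one_ne_zero
    simpa using this
  have hincr : ∀ y, |g x - g y| ≤ K / 2 := by
    intro y
    calc |g x - g y| = dist (g x) (g y) := (Real.dist_eq _ _).symm
      _ ≤ K * dist x y := hK.dist_le_mul x y
      _ ≤ K * (1 / 2) := mul_le_mul_of_nonneg_left (hdist y) K.2
      _ = K / 2 := by ring
  have hint : Integrable g volume := hg.integrable_unitAddTorus
  -- lower and upper bounds by integration against the probability measure
  have hlow : g x - K / 2 ≤ 0 := by
    have h1 : ∫ _ : UnitAddTorus d, (g x - K / 2) ≤ ∫ y, g y :=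
      integral_mono (integrable_const _) hint fun y => by
        have := (abs_le.1 (hincr y)).2
        linarith
    rw [integral_const, h0, smul_eq_mul] at h1
    simpa using h1
  have hup : 0 ≤ g x + K / 2 := by
    have h1 : ∫ y, g y ≤ ∫ _ : UnitAddTorus d, (g x + K / 2) :=
      integral_mono hint (integrable_const _) fun y => by
        have := (abs_le.1 (hincr y)).1
        linarith
    rw [integral_const, h0, smul_eq_mul] at h1
    simpa using h1
  rw [Real.norm_eq_abs, abs_le]
  constructor <;> linarith

end Torus

end Literature.Analysis.FunctionSpaces

/-! ## `∂ᵢΔ⁻¹` and `ℛ` on `C^{0,α}(T³)` -/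

namespace Literature.Analysis.FluidPDE

namespace BDSV

open FunctionSpaces FunctionSpaces.Torus

/-- **`∂ᵢΔ⁻¹` is bounded on `C^{0,α}(T³)`** (indeed of order `-1`), from the Calderón–Zygmund
bound `BDSV.holderCZBound` for `∂ₗ∂ᵢΔ⁻¹`: for `0 < α < 1` there is `C` with
`‖∂ᵢΔ⁻¹ f‖_{C^{0,α}} ≤ C ‖f‖_{C^{0,α}}` for all `i` and all smooth real `f`. Proof: the partial
derivatives `∂ₗ(∂ᵢΔ⁻¹f) = ∂ₗ∂ᵢΔ⁻¹f` are bounded pointwise by `C_CZ ‖f‖_{C^{0,α}}`, so `∂ᵢΔ⁻¹f` is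
`3√3 C_CZ‖f‖`-Lipschitz; it has zero mean (a derivative), hence sup norm `≤` half of that, and a
bounded Lipschitz function is `α`-Hölder. [cite: BuckmasterEtAl2018, App. C Prop. C.1] -/
theorem holder_partialDeriv_invLaplacian_le (hCZ : holderCZBound) {α : ℝ≥0} (hα : 0 < α)
    (hα1 : α < 1) : ∃ C : ℝ≥0, ∀ (i : Fin 3) (f : UnitAddTorus (Fin 3) → ℝ), IsSmooth f →
      Torus.eContDiffHolderNorm 0 α (partialDeriv i (invLaplacian f)) ≤
        C * Torus.eContDiffHolderNorm 0 α f := by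
  obtain ⟨C, hC⟩ := hCZ α hα hα1
  refine ⟨NNReal.sqrt 3 * (3 * C) / 2 + (NNReal.sqrt 3 * (3 * C) + 2 * (NNReal.sqrt 3 * (3 * C) / 2)),
    fun i f hf => ?_⟩
  set g : UnitAddTorus (Fin 3) → ℝ := partialDeriv i (invLaplacian f) with hg
  have hgs : IsSmooth g := (isSmooth_invLaplacian hf).partialDeriv i
  have h0mean : ∫ x, g x = 0 := integral_partialDeriv_eq_zero_holds (isSmooth_invLaplacian hf) i
  -- from a pointwise bound `‖∂ₗ g‖ ≤ K` to the `C^{0,α}` bound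
  have key : ∀ K : ℝ≥0, (∀ (l : Fin 3) (x : UnitAddTorus (Fin 3)), ‖partialDeriv l g x‖ ≤ (K : ℝ)) →
      Torus.eContDiffHolderNorm 0 α g ≤
        ((NNReal.sqrt 3 * (3 * K) / 2 +
          (NNReal.sqrt 3 * (3 * K) + 2 * (NNReal.sqrt 3 * (3 * K) / 2)) : ℝ≥0) : ℝ≥0∞) := by
    intro K hK
    have hLip := lipschitzWith_of_norm_partialDeriv_le (M := fun _ => K) (hgs.isContDiff (by simp)) hK
    have hKs : NNReal.sqrt (Fintype.card (Fin 3)) * ∑ _l : Fin 3, K = NNReal.sqrt 3 * (3 * K) := by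
      simp [Finset.sum_const, Finset.card_univ, Fintype.card_fin]
    rw [hKs] at hLip
    have hsup : ∀ x, ‖g x‖ ≤ ((NNReal.sqrt 3 * (3 * K) / 2 : ℝ≥0) : ℝ) := fun x => by
      have := norm_le_of_integral_eq_zero hgs.continuous h0mean hLip x
      simpa using this
    have hbdd := eBoundedHolderNorm_le_of_norm_le_of_norm_partialDeriv_le (M := fun _ => K)
      (hgs.isContDiff (by simp)) hα1.le hsup hK
    rw [hKs] at hbdd
    exact (eContDiffHolderNorm_zero_le_eBoundedHolderNorm α g).trans hbdd
  by_cases hBtop : Torus.eContDiffHolderNorm 0 α f = ⊤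
  · by_cases hC0 : C = 0
    · -- all second Riesz transforms vanish: `g` has vanishing partial derivatives
      have hK : ∀ (l : Fin 3) (x : UnitAddTorus (Fin 3)), ‖partialDeriv l g x‖ ≤ ((0 : ℝ≥0) : ℝ) := by
        intro l x
        have h1 : Torus.eContDiffHolderNorm 0 α (rieszHessian l i f) ≤ 0 := by
          simpa [hC0] using hC l i f hf
        have h2 := (Torus.enorm_le_eContDiffHolderNorm 0 α (rieszHessian l i f) x).trans h1
        rw [nonpos_iff_eq_zero, enorm_eq_zero] at h2
        rw [show partialDeriv l g x = rieszHessian l i f x from rfl, h2, norm_zero, NNReal.coe_zero]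
      refine (key 0 hK).trans ?_
      simp
    · have hpos : NNReal.sqrt 3 * (3 * C) / 2 +
          (NNReal.sqrt 3 * (3 * C) + 2 * (NNReal.sqrt 3 * (3 * C) / 2)) ≠ 0 := by
        have h3 : (0 : ℝ≥0) < NNReal.sqrt 3 := NNReal.sqrt_pos.2 (by norm_num)
        have hCpos : 0 < C := pos_iff_ne_zero.2 hC0
        exact (add_pos_of_nonneg_of_pos bot_le
          (add_pos_of_pos_of_nonneg (mul_pos h3 (mul_pos (by norm_num) hCpos)) bot_le)).ne'
      rw [hBtop, ENNReal.mul_top (by exact_mod_cast hpos)]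
      exact le_top
  · set b : ℝ≥0 := (Torus.eContDiffHolderNorm 0 α f).toNNReal with hb
    have hBb : Torus.eContDiffHolderNorm 0 α f = b := (ENNReal.coe_toNNReal hBtop).symm
    have hK : ∀ (l : Fin 3) (x : UnitAddTorus (Fin 3)), ‖partialDeriv l g x‖ ≤ ((C * b : ℝ≥0) : ℝ) := by
      intro l x
      have h1 : Torus.eContDiffHolderNorm 0 α (rieszHessian l i f) ≤ C * b := hBb ▸ hC l i f hf
      have h2 := (Torus.enorm_le_eContDiffHolderNorm 0 α (rieszHessian l i f) x).trans h1
      rw [← ENNReal.coe_mul, ← ofReal_norm, ← ENNReal.ofReal_coe_nnreal,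
        ENNReal.ofReal_le_ofReal_iff (by positivity)] at h2
      exact h2
    refine (key (C * b) hK).trans (le_of_eq ?_)
    rw [hBb, ← ENNReal.coe_mul]
    congr 1
    ring

/-! ### The entries and the matrix field of `ℛ` -/

section Antidivergence

variable {v : UnitAddTorus (Fin 3) → EuclideanSpace ℝ (Fin 3)}

/-- `∑ᵢ wᵢ • eᵢ = w` in `ℝ^ι`. [folklore] -/
theorem _root_.EuclideanSpace.sum_apply_smul_single_real {ι : Type*} [Fintype ι] [DecidableEq ι]
    (w : EuclideanSpace ℝ ι) : ∑ j, w j • EuclideanSpace.single j (1 : ℝ) = w := by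
  conv_rhs => rw [← (EuclideanSpace.basisFun ι ℝ).sum_repr w]
  simp [EuclideanSpace.basisFun_apply]

/-- The elementary matrices `eⱼ ⊗ eᵢ` of the column representation `Fin 3 → EuclideanSpace ℝ (Fin 3)` (column `j`
equal to `eᵢ`, the others zero) have norm `1`. [folklore] -/
theorem norm_single_single (i j : Fin 3) :
    ‖(Pi.single j (EuclideanSpace.single i (1 : ℝ)) : Fin 3 → EuclideanSpace ℝ (Fin 3))‖ = 1 := by
  rw [Pi.norm_single]
  simp

/-- The matrix field of `ℛ` expanded along the elementary matrices `eⱼ ⊗ eᵢ`: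
`ℛv = ∑ⱼ ∑ᵢ (ℛv)ᵢⱼ eⱼ ⊗ eᵢ`. [folklore] -/
theorem antidivergence_eq_sum_single (v : UnitAddTorus (Fin 3) → EuclideanSpace ℝ (Fin 3)) :
    Torus.antidivergence v = ∑ j : Fin 3, ∑ i : Fin 3, fun x => Torus.antidivEntry v i j x • (Pi.single j (EuclideanSpace.single i (1 : ℝ)) : Fin 3 → EuclideanSpace ℝ (Fin 3)) := by
  funext x j'
  symm
  simp only [Finset.sum_apply, Pi.smul_apply]
  rw [Finset.sum_eq_single j']
  · simp only [Pi.single_eq_same]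
    exact EuclideanSpace.sum_apply_smul_single_real (WithLp.toLp 2 fun i => Torus.antidivEntry v i j' x)
  · intro j _ hj
    simp [Pi.single_eq_of_ne (Ne.symm hj)]
  · intro h
    exact absurd (Finset.mem_univ j') h

/-- The entry `(ℛv)ᵢⱼ` as a combination of `∂ᵢΔ⁻¹vⱼ`, `∂ⱼΔ⁻¹vᵢ`, `div Δ⁻¹v` and
`∂ᵢ∂ⱼΔ⁻¹ div Δ⁻¹ v` (`d = 3`: coefficients `-1/2`, `-1/2`). [folklore] -/
theorem antidivEntry_eq_fun (v : UnitAddTorus (Fin 3) → EuclideanSpace ℝ (Fin 3)) (i j : Fin 3) :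
    (fun x => Torus.antidivEntry v i j x) =
      partialDeriv i (Torus.antidivPotential v j) + partialDeriv j (Torus.antidivPotential v i) +
        (-(1 / 2 : ℝ)) • (if i = j then Torus.antidivDiv v else 0) +
        (-(1 / 2 : ℝ)) • rieszHessian i j (Torus.antidivDiv v) := by
  funext x
  by_cases h : i = j
  · simp only [h, Torus.antidivEntry, Pi.add_apply, Pi.smul_apply, smul_eq_mul, rieszHessian,
      Torus.antidivPhi, Fintype.card_fin, if_true, Nat.cast_ofNat]
    norm_num
    ring
  · simp only [h, Torus.antidivEntry, Pi.add_apply, Pi.smul_apply, smul_eq_mul, rieszHessian,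
      Torus.antidivPhi, Fintype.card_fin, if_false, Nat.cast_ofNat, Pi.zero_apply]
    norm_num

variable (hCZ : holderCZBound)
include hCZ

/-- **`ℛ` is bounded on `C^{0,α}(T³)`**: for `0 < α < 1` there is `C` such that
`‖ℛv‖_{C^{0,α}} ≤ C ‖v‖_{C^{0,α}}` for every smooth vector field `v` on `T³` (`ℛ` is an operator of
order `-1`, built from `∂ᵢΔ⁻¹` and the Calderón–Zygmund operators `∂ᵢ∂ⱼΔ⁻¹`; from
`BDSV.holderCZBound` = BDSV Prop. C.1). This is the bound behind "`‖𝒪₂‖_α ≲ ‖w_o ⊗ w_c + …‖_α`"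
(BDSV §6.1.3, arXiv (6.9)). [cite: BuckmasterEtAl2018, App. C Prop. C.1] -/
theorem holder_antidivergence_le {α : ℝ≥0} (hα : 0 < α) (hα1 : α < 1) :
    ∃ C : ℝ≥0, ∀ v : UnitAddTorus (Fin 3) → EuclideanSpace ℝ (Fin 3), IsSmooth v →
      Torus.eContDiffHolderNorm 0 α (Torus.antidivergence v) ≤
        C * Torus.eContDiffHolderNorm 0 α v := by
  obtain ⟨C₁, h₁⟩ := holder_partialDeriv_invLaplacian_le hCZ hα hα1
  obtain ⟨C₂, h₂⟩ := hCZ α hα hα1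
  refine ⟨9 * (5 * C₁ + 3 * (C₂ * C₁)), fun v hv => ?_⟩
  set N : ℝ≥0∞ := Torus.eContDiffHolderNorm 0 α v with hN
  -- components
  have hvj : ∀ j, IsSmooth (fun x => v x j) := fun j => hv.apply j
  have hNj : ∀ j, Torus.eContDiffHolderNorm 0 α (fun x => v x j) ≤ N := fun j =>
    eContDiffHolderNorm_zero_apply_le α v j
  -- `∂ᵢΔ⁻¹vⱼ`
  have hP : ∀ i j, Torus.eContDiffHolderNorm 0 α (partialDeriv i (Torus.antidivPotential v j)) ≤ C₁ * N :=
    fun i j => (h₁ i _ (hvj j)).trans (mul_le_mul_of_nonneg_left (hNj j) bot_le)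
  have hPs : ∀ i j, IsSmooth (partialDeriv i (Torus.antidivPotential v j)) :=
    fun i j => (Torus.isSmooth_antidivPotential hv j).partialDeriv i
  -- `div Δ⁻¹ v`
  have hDs : IsSmooth (Torus.antidivDiv v) := Torus.isSmooth_antidivDiv hv
  have hDeq : Torus.antidivDiv v = ∑ l : Fin 3, partialDeriv l (Torus.antidivPotential v l) := by
    funext x
    simp [Torus.antidivDiv, Finset.sum_apply]
  have hD : Torus.eContDiffHolderNorm 0 α (Torus.antidivDiv v) ≤ 3 * (C₁ * N) := by
    rw [hDeq]
    refine (FunctionSpaces.Torus.eContDiffHolderNorm_sum_le (k := 0) Finset.univ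
      (fun l _ => (hPs l l).isContDiff (by simp))).trans ?_
    calc ∑ l : Fin 3, Torus.eContDiffHolderNorm 0 α (partialDeriv l (Torus.antidivPotential v l))
        ≤ ∑ _l : Fin 3, C₁ * N := Finset.sum_le_sum fun l _ => hP l l
      _ = 3 * (C₁ * N) := by
          simp [Finset.sum_const, Finset.card_univ, Fintype.card_fin]
  -- the Calderón–Zygmund term
  have hR : ∀ i j, Torus.eContDiffHolderNorm 0 α (rieszHessian i j (Torus.antidivDiv v)) ≤
      C₂ * (3 * (C₁ * N)) :=
    fun i j => (h₂ i j _ hDs).trans (mul_le_mul_of_nonneg_left hD bot_le)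
  have hhalf : ‖(-(1 / 2 : ℝ))‖ₑ ≤ 1 := by
    rw [Real.enorm_eq_ofReal_abs]
    exact ENNReal.ofReal_le_one.2 (by norm_num)
  -- the entries
  have hE : ∀ i j, Torus.eContDiffHolderNorm 0 α (fun x => Torus.antidivEntry v i j x) ≤
      (5 * C₁ + 3 * (C₂ * C₁) : ℝ≥0) * N := by
    intro i j
    rw [antidivEntry_eq_fun v i j]
    have hIs : IsSmooth (if i = j then Torus.antidivDiv v else (0 : UnitAddTorus (Fin 3) → ℝ)) := by
      split_ifs
      · exact hDs
      · exact isSmooth_const _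
    have hI : Torus.eContDiffHolderNorm 0 α (if i = j then Torus.antidivDiv v else (0 : UnitAddTorus (Fin 3) → ℝ)) ≤
        3 * (C₁ * N) := by
      split_ifs
      · exact hD
      · rw [FunctionSpaces.Torus.eContDiffHolderNorm_zero_fun]
        exact bot_le
    have hRs : IsSmooth (rieszHessian i j (Torus.antidivDiv v)) := isSmooth_rieszHessian hDs i j
    have s1 : IsContDiff ((0 : ℕ) : WithTop ℕ∞)
        (partialDeriv i (Torus.antidivPotential v j) + partialDeriv j (Torus.antidivPotential v i)) :=
      ((hPs i j).add (hPs j i)).isContDiff (by simp)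
    have s2 : IsContDiff ((0 : ℕ) : WithTop ℕ∞)
        ((-(1 / 2 : ℝ)) • (if i = j then Torus.antidivDiv v else (0 : UnitAddTorus (Fin 3) → ℝ))) :=
      (hIs.smul _).isContDiff (by simp)
    have s3 : IsContDiff ((0 : ℕ) : WithTop ℕ∞) ((-(1 / 2 : ℝ)) • rieszHessian i j (Torus.antidivDiv v)) :=
      (hRs.smul _).isContDiff (by simp)
    calc Torus.eContDiffHolderNorm 0 α
          (partialDeriv i (Torus.antidivPotential v j) + partialDeriv j (Torus.antidivPotential v i) +
            (-(1 / 2 : ℝ)) • (if i = j then Torus.antidivDiv v else 0) +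
            (-(1 / 2 : ℝ)) • rieszHessian i j (Torus.antidivDiv v))
        ≤ Torus.eContDiffHolderNorm 0 α
            (partialDeriv i (Torus.antidivPotential v j) + partialDeriv j (Torus.antidivPotential v i) +
              (-(1 / 2 : ℝ)) • (if i = j then Torus.antidivDiv v else 0)) +
          Torus.eContDiffHolderNorm 0 α ((-(1 / 2 : ℝ)) • rieszHessian i j (Torus.antidivDiv v)) :=
          FunctionSpaces.Torus.eContDiffHolderNorm_add_le (s1.add s2) s3
      _ ≤ (Torus.eContDiffHolderNorm 0 α
            (partialDeriv i (Torus.antidivPotential v j) + partialDeriv j (Torus.antidivPotential v i)) +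
            Torus.eContDiffHolderNorm 0 α ((-(1 / 2 : ℝ)) • (if i = j then Torus.antidivDiv v else 0))) +
          Torus.eContDiffHolderNorm 0 α ((-(1 / 2 : ℝ)) • rieszHessian i j (Torus.antidivDiv v)) :=
          add_le_add (FunctionSpaces.Torus.eContDiffHolderNorm_add_le s1 s2) le_rfl
      _ ≤ ((C₁ * N + C₁ * N) + 1 * (3 * (C₁ * N))) + 1 * (C₂ * (3 * (C₁ * N))) := by
          refine add_le_add (add_le_add ?_ ?_) ?_
          · exact (FunctionSpaces.Torus.eContDiffHolderNorm_add_le (k := 0) ((hPs i j).isContDiff (by simp))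
              ((hPs j i).isContDiff (by simp))).trans (add_le_add (hP i j) (hP j i))
          · rw [FunctionSpaces.Torus.eContDiffHolderNorm_const_smul (k := 0) (hIs.isContDiff (by simp))]
            exact mul_le_mul hhalf hI bot_le bot_le
          · rw [FunctionSpaces.Torus.eContDiffHolderNorm_const_smul (k := 0) (hRs.isContDiff (by simp))]
            exact mul_le_mul hhalf (hR i j) bot_le bot_le
      _ = (5 * C₁ + 3 * (C₂ * C₁) : ℝ≥0) * N := by
          push_cast
          ring
  -- the matrix field: each term `x ↦ (ℛv)ᵢⱼ(x) • (eⱼ ⊗ eᵢ)` is a rank-one image of the entry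
  have hEs : ∀ i j, IsSmooth (fun x => Torus.antidivEntry v i j x • (Pi.single j (EuclideanSpace.single i (1 : ℝ)) : Fin 3 → EuclideanSpace ℝ (Fin 3))) :=
    fun i j => (Torus.isSmooth_antidivEntry hv i j).smul' (isSmooth_const _)
  have hT : ∀ i j, Torus.eContDiffHolderNorm 0 α (fun x => Torus.antidivEntry v i j x • (Pi.single j (EuclideanSpace.single i (1 : ℝ)) : Fin 3 → EuclideanSpace ℝ (Fin 3))) ≤
      (5 * C₁ + 3 * (C₂ * C₁) : ℝ≥0) * N := by
    intro i j
    set L : ℝ →L[ℝ] (Fin 3 → EuclideanSpace ℝ (Fin 3)) := (ContinuousLinearMap.id ℝ ℝ).smulRight ((Pi.single j (EuclideanSpace.single i (1 : ℝ)) : Fin 3 → EuclideanSpace ℝ (Fin 3))) with hL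
    have hLn : ‖L‖₊ ≤ 1 := by
      rw [← NNReal.coe_le_coe, coe_nnnorm, NNReal.coe_one]
      refine ContinuousLinearMap.opNorm_le_bound _ zero_le_one fun t => ?_
      rw [hL, ContinuousLinearMap.smulRight_apply, ContinuousLinearMap.id_apply, norm_smul,
        norm_single_single, mul_one, one_mul]
    have h := eContDiffHolderNorm_zero_clm_comp_le L α (fun x => Torus.antidivEntry v i j x)
    have hfun : (fun x => L (Torus.antidivEntry v i j x)) =
        fun x => Torus.antidivEntry v i j x • (Pi.single j (EuclideanSpace.single i (1 : ℝ)) : Fin 3 → EuclideanSpace ℝ (Fin 3)) := by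
      funext x
      rw [hL, ContinuousLinearMap.smulRight_apply, ContinuousLinearMap.id_apply]
    rw [hfun] at h
    calc Torus.eContDiffHolderNorm 0 α (fun x => Torus.antidivEntry v i j x • (Pi.single j (EuclideanSpace.single i (1 : ℝ)) : Fin 3 → EuclideanSpace ℝ (Fin 3)))
        ≤ ‖L‖₊ * Torus.eContDiffHolderNorm 0 α (fun x => Torus.antidivEntry v i j x) := h
      _ ≤ 1 * ((5 * C₁ + 3 * (C₂ * C₁) : ℝ≥0) * N) :=
          mul_le_mul (by exact_mod_cast hLn) (hE i j) bot_le bot_le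
      _ = _ := one_mul _
  have hcol : ∀ j, IsContDiff ((0 : ℕ) : WithTop ℕ∞)
      (∑ i : Fin 3, fun x => Torus.antidivEntry v i j x • (Pi.single j (EuclideanSpace.single i (1 : ℝ)) : Fin 3 → EuclideanSpace ℝ (Fin 3))) := by
    intro j
    have h : ∀ i ∈ (Finset.univ : Finset (Fin 3)),
        IsContDiff ((0 : ℕ) : WithTop ℕ∞) (fun x => Torus.antidivEntry v i j x • (Pi.single j (EuclideanSpace.single i (1 : ℝ)) : Fin 3 → EuclideanSpace ℝ (Fin 3))) :=
      fun i _ => (hEs i j).isContDiff (by simp)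
    unfold IsContDiff at h ⊢
    rw [lift_sum, Finset.sum_fn]
    exact ContDiff.sum h
  rw [antidivergence_eq_sum_single v]
  calc Torus.eContDiffHolderNorm 0 α
        (∑ j : Fin 3, ∑ i : Fin 3, fun x => Torus.antidivEntry v i j x • (Pi.single j (EuclideanSpace.single i (1 : ℝ)) : Fin 3 → EuclideanSpace ℝ (Fin 3)))
      ≤ ∑ j : Fin 3, Torus.eContDiffHolderNorm 0 α
          (∑ i : Fin 3, fun x => Torus.antidivEntry v i j x • (Pi.single j (EuclideanSpace.single i (1 : ℝ)) : Fin 3 → EuclideanSpace ℝ (Fin 3))) :=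
        FunctionSpaces.Torus.eContDiffHolderNorm_sum_le (k := 0) Finset.univ fun j _ => hcol j
    _ ≤ ∑ j : Fin 3, ∑ i : Fin 3,
          Torus.eContDiffHolderNorm 0 α (fun x => Torus.antidivEntry v i j x • (Pi.single j (EuclideanSpace.single i (1 : ℝ)) : Fin 3 → EuclideanSpace ℝ (Fin 3))) :=
        Finset.sum_le_sum fun j _ => FunctionSpaces.Torus.eContDiffHolderNorm_sum_le (k := 0) Finset.univ
          fun i _ => (hEs i j).isContDiff (by simp)
    _ ≤ ∑ _j : Fin 3, ∑ _i : Fin 3, ((5 * C₁ + 3 * (C₂ * C₁) : ℝ≥0) : ℝ≥0∞) * N :=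
        Finset.sum_le_sum fun j _ => Finset.sum_le_sum fun i _ => hT i j
    _ = ((9 * (5 * C₁ + 3 * (C₂ * C₁)) : ℝ≥0) : ℝ≥0∞) * N := by
        simp only [Finset.sum_const, Finset.card_univ, Fintype.card_fin, nsmul_eq_mul]
        push_cast
        ring

/-! ### `ℛ ∘ div` is bounded on `C^{0,α}` (an operator of order `0`) -/

omit hCZ in
/-- Abstract assembly: if the first derivatives of the potentials `∂ᵢΔ⁻¹vⱼ` of a smooth field `v`
are bounded in `C^{0,α}` by `K`, then `‖ℛv‖_{C^{0,α}} ≤ 9(5 + 3C_CZ) K`, where `C_CZ` bounds the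
second Riesz transforms on `C^{0,α}` (the bookkeeping of `BDSV.holder_antidivergence_le`).
[folklore] -/
theorem holder_antidivergence_le_of_potential_bound {α : ℝ≥0} {C₂ : ℝ≥0}
    (h₂ : ∀ (i j : Fin 3) (f : UnitAddTorus (Fin 3) → ℝ), IsSmooth f →
      Torus.eContDiffHolderNorm 0 α (rieszHessian i j f) ≤ C₂ * Torus.eContDiffHolderNorm 0 α f)
    (hv : IsSmooth v) {K : ℝ≥0∞}
    (hP : ∀ i j, Torus.eContDiffHolderNorm 0 α (partialDeriv i (Torus.antidivPotential v j)) ≤ K) :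
    Torus.eContDiffHolderNorm 0 α (Torus.antidivergence v) ≤ (9 * (5 + 3 * C₂) : ℝ≥0) * K := by
  have hPs : ∀ i j, IsSmooth (partialDeriv i (Torus.antidivPotential v j)) :=
    fun i j => (Torus.isSmooth_antidivPotential hv j).partialDeriv i
  have hDs : IsSmooth (Torus.antidivDiv v) := Torus.isSmooth_antidivDiv hv
  have hDeq : Torus.antidivDiv v = ∑ l : Fin 3, partialDeriv l (Torus.antidivPotential v l) := by
    funext x
    simp [Torus.antidivDiv, Finset.sum_apply]
  have hD : Torus.eContDiffHolderNorm 0 α (Torus.antidivDiv v) ≤ 3 * K := by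
    rw [hDeq]
    refine (FunctionSpaces.Torus.eContDiffHolderNorm_sum_le (k := 0) Finset.univ
      (fun l _ => (hPs l l).isContDiff (by simp))).trans ?_
    calc ∑ l : Fin 3, Torus.eContDiffHolderNorm 0 α (partialDeriv l (Torus.antidivPotential v l))
        ≤ ∑ _l : Fin 3, K := Finset.sum_le_sum fun l _ => hP l l
      _ = 3 * K := by
          simp [Finset.sum_const, Finset.card_univ, Fintype.card_fin]
  have hR : ∀ i j, Torus.eContDiffHolderNorm 0 α (rieszHessian i j (Torus.antidivDiv v)) ≤ C₂ * (3 * K) :=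
    fun i j => (h₂ i j _ hDs).trans (mul_le_mul_of_nonneg_left hD bot_le)
  have hhalf : ‖(-(1 / 2 : ℝ))‖ₑ ≤ 1 := by
    rw [Real.enorm_eq_ofReal_abs]
    exact ENNReal.ofReal_le_one.2 (by norm_num)
  have hE : ∀ i j, Torus.eContDiffHolderNorm 0 α (fun x => Torus.antidivEntry v i j x) ≤
      (5 + 3 * C₂ : ℝ≥0) * K := by
    intro i j
    rw [antidivEntry_eq_fun v i j]
    have hIs : IsSmooth (if i = j then Torus.antidivDiv v else (0 : UnitAddTorus (Fin 3) → ℝ)) := by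
      split_ifs
      · exact hDs
      · exact isSmooth_const _
    have hI : Torus.eContDiffHolderNorm 0 α
        (if i = j then Torus.antidivDiv v else (0 : UnitAddTorus (Fin 3) → ℝ)) ≤ 3 * K := by
      split_ifs
      · exact hD
      · rw [FunctionSpaces.Torus.eContDiffHolderNorm_zero_fun]
        exact bot_le
    have hRs : IsSmooth (rieszHessian i j (Torus.antidivDiv v)) := isSmooth_rieszHessian hDs i j
    have s1 : IsContDiff ((0 : ℕ) : WithTop ℕ∞)
        (partialDeriv i (Torus.antidivPotential v j) + partialDeriv j (Torus.antidivPotential v i)) :=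
      ((hPs i j).add (hPs j i)).isContDiff (by simp)
    have s2 : IsContDiff ((0 : ℕ) : WithTop ℕ∞)
        ((-(1 / 2 : ℝ)) • (if i = j then Torus.antidivDiv v else (0 : UnitAddTorus (Fin 3) → ℝ))) :=
      (hIs.smul _).isContDiff (by simp)
    have s3 : IsContDiff ((0 : ℕ) : WithTop ℕ∞) ((-(1 / 2 : ℝ)) • rieszHessian i j (Torus.antidivDiv v)) :=
      (hRs.smul _).isContDiff (by simp)
    calc Torus.eContDiffHolderNorm 0 α
          (partialDeriv i (Torus.antidivPotential v j) + partialDeriv j (Torus.antidivPotential v i) +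
            (-(1 / 2 : ℝ)) • (if i = j then Torus.antidivDiv v else 0) +
            (-(1 / 2 : ℝ)) • rieszHessian i j (Torus.antidivDiv v))
        ≤ Torus.eContDiffHolderNorm 0 α
            (partialDeriv i (Torus.antidivPotential v j) + partialDeriv j (Torus.antidivPotential v i) +
              (-(1 / 2 : ℝ)) • (if i = j then Torus.antidivDiv v else 0)) +
          Torus.eContDiffHolderNorm 0 α ((-(1 / 2 : ℝ)) • rieszHessian i j (Torus.antidivDiv v)) :=
          FunctionSpaces.Torus.eContDiffHolderNorm_add_le (s1.add s2) s3
      _ ≤ (Torus.eContDiffHolderNorm 0 α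
            (partialDeriv i (Torus.antidivPotential v j) + partialDeriv j (Torus.antidivPotential v i)) +
            Torus.eContDiffHolderNorm 0 α ((-(1 / 2 : ℝ)) • (if i = j then Torus.antidivDiv v else 0))) +
          Torus.eContDiffHolderNorm 0 α ((-(1 / 2 : ℝ)) • rieszHessian i j (Torus.antidivDiv v)) :=
          add_le_add (FunctionSpaces.Torus.eContDiffHolderNorm_add_le s1 s2) le_rfl
      _ ≤ ((K + K) + 1 * (3 * K)) + 1 * (C₂ * (3 * K)) := by
          refine add_le_add (add_le_add ?_ ?_) ?_
          · exact (FunctionSpaces.Torus.eContDiffHolderNorm_add_le (k := 0) ((hPs i j).isContDiff (by simp))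
              ((hPs j i).isContDiff (by simp))).trans (add_le_add (hP i j) (hP j i))
          · rw [FunctionSpaces.Torus.eContDiffHolderNorm_const_smul (k := 0) (hIs.isContDiff (by simp))]
            exact mul_le_mul hhalf hI bot_le bot_le
          · rw [FunctionSpaces.Torus.eContDiffHolderNorm_const_smul (k := 0) (hRs.isContDiff (by simp))]
            exact mul_le_mul hhalf (hR i j) bot_le bot_le
      _ = (5 + 3 * C₂ : ℝ≥0) * K := by
          push_cast
          ring
  have hEs : ∀ i j, IsSmooth (fun x => Torus.antidivEntry v i j x •
      (Pi.single j (EuclideanSpace.single i (1 : ℝ)) : Fin 3 → EuclideanSpace ℝ (Fin 3))) :=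
    fun i j => (Torus.isSmooth_antidivEntry hv i j).smul' (isSmooth_const _)
  have hT : ∀ i j, Torus.eContDiffHolderNorm 0 α (fun x => Torus.antidivEntry v i j x •
      (Pi.single j (EuclideanSpace.single i (1 : ℝ)) : Fin 3 → EuclideanSpace ℝ (Fin 3))) ≤
      (5 + 3 * C₂ : ℝ≥0) * K := by
    intro i j
    set L : ℝ →L[ℝ] (Fin 3 → EuclideanSpace ℝ (Fin 3)) := (ContinuousLinearMap.id ℝ ℝ).smulRight
      (Pi.single j (EuclideanSpace.single i (1 : ℝ)) : Fin 3 → EuclideanSpace ℝ (Fin 3)) with hL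
    have hLn : ‖L‖₊ ≤ 1 := by
      rw [← NNReal.coe_le_coe, coe_nnnorm, NNReal.coe_one]
      refine ContinuousLinearMap.opNorm_le_bound _ zero_le_one fun t => ?_
      rw [hL, ContinuousLinearMap.smulRight_apply, ContinuousLinearMap.id_apply, norm_smul,
        norm_single_single, mul_one, one_mul]
    have h := eContDiffHolderNorm_zero_clm_comp_le L α (fun x => Torus.antidivEntry v i j x)
    have hfun : (fun x => L (Torus.antidivEntry v i j x)) = fun x => Torus.antidivEntry v i j x •
        (Pi.single j (EuclideanSpace.single i (1 : ℝ)) : Fin 3 → EuclideanSpace ℝ (Fin 3)) := by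
      funext x
      rw [hL, ContinuousLinearMap.smulRight_apply, ContinuousLinearMap.id_apply]
    rw [hfun] at h
    calc _ ≤ ‖L‖₊ * Torus.eContDiffHolderNorm 0 α (fun x => Torus.antidivEntry v i j x) := h
      _ ≤ 1 * ((5 + 3 * C₂ : ℝ≥0) * K) := mul_le_mul (by exact_mod_cast hLn) (hE i j) bot_le bot_le
      _ = _ := one_mul _
  have hcol : ∀ j, IsContDiff ((0 : ℕ) : WithTop ℕ∞)
      (∑ i : Fin 3, fun x => Torus.antidivEntry v i j x •
        (Pi.single j (EuclideanSpace.single i (1 : ℝ)) : Fin 3 → EuclideanSpace ℝ (Fin 3))) := by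
    intro j
    have h : ∀ i ∈ (Finset.univ : Finset (Fin 3)),
        IsContDiff ((0 : ℕ) : WithTop ℕ∞) (fun x => Torus.antidivEntry v i j x •
          (Pi.single j (EuclideanSpace.single i (1 : ℝ)) : Fin 3 → EuclideanSpace ℝ (Fin 3))) :=
      fun i _ => (hEs i j).isContDiff (by simp)
    unfold IsContDiff at h ⊢
    rw [lift_sum, Finset.sum_fn]
    exact ContDiff.sum h
  rw [antidivergence_eq_sum_single v]
  calc Torus.eContDiffHolderNorm 0 α
        (∑ j : Fin 3, ∑ i : Fin 3, fun x => Torus.antidivEntry v i j x •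
          (Pi.single j (EuclideanSpace.single i (1 : ℝ)) : Fin 3 → EuclideanSpace ℝ (Fin 3)))
      ≤ ∑ j : Fin 3, Torus.eContDiffHolderNorm 0 α
          (∑ i : Fin 3, fun x => Torus.antidivEntry v i j x •
            (Pi.single j (EuclideanSpace.single i (1 : ℝ)) : Fin 3 → EuclideanSpace ℝ (Fin 3))) :=
        FunctionSpaces.Torus.eContDiffHolderNorm_sum_le (k := 0) Finset.univ fun j _ => hcol j
    _ ≤ ∑ j : Fin 3, ∑ i : Fin 3, Torus.eContDiffHolderNorm 0 α (fun x => Torus.antidivEntry v i j x •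
          (Pi.single j (EuclideanSpace.single i (1 : ℝ)) : Fin 3 → EuclideanSpace ℝ (Fin 3))) :=
        Finset.sum_le_sum fun j _ => FunctionSpaces.Torus.eContDiffHolderNorm_sum_le (k := 0)
          Finset.univ fun i _ => (hEs i j).isContDiff (by simp)
    _ ≤ ∑ _j : Fin 3, ∑ _i : Fin 3, ((5 + 3 * C₂ : ℝ≥0) : ℝ≥0∞) * K :=
        Finset.sum_le_sum fun j _ => Finset.sum_le_sum fun i _ => hT i j
    _ = ((9 * (5 + 3 * C₂)) : ℝ≥0) * K := by
        simp only [Finset.sum_const, Finset.card_univ, Fintype.card_fin, nsmul_eq_mul]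
        push_cast
        ring

omit hCZ in
/-- Components `x ↦ A(x)ₗⱼ` of a tensor field stored by columns are dominated in `C^{0,r}` by the
field. [folklore] -/
theorem eContDiffHolderNorm_tensor_entry_le (r : ℝ≥0)
    (A : UnitAddTorus (Fin 3) → Fin 3 → EuclideanSpace ℝ (Fin 3)) (l j : Fin 3) :
    Torus.eContDiffHolderNorm 0 r (fun x => A x l j) ≤ Torus.eContDiffHolderNorm 0 r A := by
  set L : (Fin 3 → EuclideanSpace ℝ (Fin 3)) →L[ℝ] ℝ :=
    (EuclideanSpace.proj (𝕜 := ℝ) j).comp (ContinuousLinearMap.proj l) with hL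
  have hLn : ‖L‖₊ ≤ 1 := by
    rw [← NNReal.coe_le_coe, coe_nnnorm, NNReal.coe_one]
    refine ContinuousLinearMap.opNorm_le_bound _ zero_le_one fun B => ?_
    rw [one_mul, hL, ContinuousLinearMap.comp_apply, ContinuousLinearMap.proj_apply]
    exact (PiLp.norm_apply_le (B l) j).trans (norm_le_pi_norm B l)
  have h := eContDiffHolderNorm_zero_clm_comp_le L r A
  calc Torus.eContDiffHolderNorm 0 r (fun x => A x l j)
      = Torus.eContDiffHolderNorm 0 r (fun x => L (A x)) := rfl
    _ ≤ ‖L‖₊ * Torus.eContDiffHolderNorm 0 r A := h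
    _ ≤ 1 * Torus.eContDiffHolderNorm 0 r A := by
        gcongr
        exact_mod_cast hLn
    _ = _ := one_mul _

/-- **`ℛ ∘ div` is bounded on `C^{0,α}(T³)`**: for `0 < α < 1` there is `C` with
`‖ℛ(div A)‖_{C^{0,α}} ≤ C ‖A‖_{C^{0,α}}` for every smooth tensor field `A` (columns
`A(x) eⱼ ∈ ℝ³`, `div` = `Torus.tensorDivergence`): the potentials are
`∂ᵢΔ⁻¹(div A)ⱼ = Σₗ ∂ᵢ∂ₗΔ⁻¹ Aⱼₗ`, sums of second Riesz transforms of the entries (`∂ᵢ` commutes with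
`Δ⁻¹`, `Torus.partialDeriv_invLaplacian`), so `BDSV.holderCZBound` applies directly. This is the
bound "`‖𝒪₂‖_α ≲ ‖w_o ⊗ w_c + w_c ⊗ w_o + w_c ⊗ w_c‖_α`" of BDSV §6.1.3 (arXiv (6.9); `ℛ div` is a
Calderón–Zygmund operator of order `0`). [cite: BuckmasterEtAl2018, App. C Prop. C.1] -/
theorem holder_antidivergence_tensorDivergence_le {α : ℝ≥0} (hα : 0 < α) (hα1 : α < 1) :
    ∃ C : ℝ≥0, ∀ A : UnitAddTorus (Fin 3) → Fin 3 → EuclideanSpace ℝ (Fin 3), IsSmooth A →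
      Torus.eContDiffHolderNorm 0 α (Torus.antidivergence (Torus.tensorDivergence A)) ≤
        C * Torus.eContDiffHolderNorm 0 α A := by
  obtain ⟨C₂, h₂⟩ := hCZ α hα hα1
  refine ⟨9 * (5 + 3 * C₂) * (3 * C₂), fun A hA => ?_⟩
  -- the entries of `A` and their smoothness
  set Ac : Fin 3 → Fin 3 → UnitAddTorus (Fin 3) → ℝ := fun l j x => A x l j with hAc
  have hcol : ∀ l, IsSmooth (fun x => A x l) := fun l =>
    hA.comp_clm (ContinuousLinearMap.proj (R := ℝ) (φ := fun _ : Fin 3 => EuclideanSpace ℝ (Fin 3)) l)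
  have hAc_s : ∀ l j, IsSmooth (Ac l j) := fun l j => (hcol l).apply j
  have hAc_n : ∀ l j, Torus.eContDiffHolderNorm 0 α (Ac l j) ≤ Torus.eContDiffHolderNorm 0 α A :=
    fun l j => eContDiffHolderNorm_tensor_entry_le α A l j
  -- `div A` is smooth, with components `Σₗ ∂ₗ A_{lj}`
  set v : UnitAddTorus (Fin 3) → EuclideanSpace ℝ (Fin 3) := Torus.tensorDivergence A with hvdef
  have hv : IsSmooth v := Torus.isSmooth_finset_sum Finset.univ fun l _ => (hcol l).partialDeriv l
  have hvj : ∀ j, (fun x => v x j) = ∑ l : Fin 3, partialDeriv l (Ac l j) := by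
    intro j
    funext x
    rw [Finset.sum_apply]
    simp only [hvdef, Torus.tensorDivergence, WithLp.ofLp_sum, Finset.sum_apply]
    refine Finset.sum_congr rfl fun l _ => ?_
    exact (partialDeriv_apply_coord ((hcol l).isContDiff (by simp)) l x j).symm
  -- the potentials: `∂ᵢΔ⁻¹vⱼ = Σₗ ∂ᵢ∂ₗΔ⁻¹ A_{lj}`
  have hpot : ∀ i j, partialDeriv i (Torus.antidivPotential v j) =
      ∑ l : Fin 3, rieszHessian i l (Ac l j) := by
    intro i j
    have h1 : Torus.antidivPotential v j = ∑ l : Fin 3, invLaplacian (partialDeriv l (Ac l j)) := by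
      rw [Torus.antidivPotential, hvj j, invLaplacian_finset_sum Finset.univ
        fun l _ => (hAc_s l j).partialDeriv l]
    funext x
    rw [h1, Finset.sum_apply,
      show (∑ l : Fin 3, invLaplacian (partialDeriv l (Ac l j))) =
        fun y => ∑ l : Fin 3, invLaplacian (partialDeriv l (Ac l j)) y from
        funext fun y => Finset.sum_apply y _ _,
      partialDeriv_finset_sum Finset.univ
        (fun l _ => (isSmooth_invLaplacian ((hAc_s l j).partialDeriv l)).isContDiff (by simp)) i x]
    refine Finset.sum_congr rfl fun l _ => ?_
    exact (rieszHessian_eq_partialDeriv_invLaplacian_partialDeriv (hAc_s l j) i l x).symm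
  have hP : ∀ i j, Torus.eContDiffHolderNorm 0 α (partialDeriv i (Torus.antidivPotential v j)) ≤
      ((3 * C₂ : ℝ≥0) : ℝ≥0∞) * Torus.eContDiffHolderNorm 0 α A := by
    intro i j
    rw [hpot i j]
    refine (FunctionSpaces.Torus.eContDiffHolderNorm_sum_le (k := 0) Finset.univ
      (fun l _ => (isSmooth_rieszHessian (hAc_s l j) i l).isContDiff (by simp))).trans ?_
    calc ∑ l : Fin 3, Torus.eContDiffHolderNorm 0 α (rieszHessian i l (Ac l j))
        ≤ ∑ _l : Fin 3, (C₂ : ℝ≥0∞) * Torus.eContDiffHolderNorm 0 α A :=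
          Finset.sum_le_sum fun l _ =>
            (h₂ i l _ (hAc_s l j)).trans (mul_le_mul_of_nonneg_left (hAc_n l j) bot_le)
      _ = ((3 * C₂ : ℝ≥0) : ℝ≥0∞) * Torus.eContDiffHolderNorm 0 α A := by
          simp only [Finset.sum_const, Finset.card_univ, Fintype.card_fin, nsmul_eq_mul]
          push_cast
          ring
  refine (holder_antidivergence_le_of_potential_bound h₂ hv hP).trans (le_of_eq ?_)
  push_cast
  ring

end Antidivergence

end BDSV

end Literature.Analysis.FluidPDE
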